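import Literature.Analysis.FluidPDE.SelfSimilarEulerEnergyGrowth
import Literature.Analysis.FluidPDE.PressurePoisson
import HarnessLib

/-!
# The pressure–Poisson equation of a self-similar Euler profile holds automatically, and
Chae–Shvydkoy 2013 Thm 3.2 / Cor 3.4 without the weak-Poisson hypothesis

Analysis/FluidPDE proof file (theorems only; no definitions, no named facts, no `sorry`).

For a stationary self-similar Euler profile `(U, P)` in the tree's sense
(`IsSelfSimilarEulerProfile γ c U P`: `U ∈ C²`, `P ∈ C¹`, `(1−γ)U + DU[γ(y−c) + U] + ∇P = 0`,
`div U = 0`) the **weak pressure–Poisson equation**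
`∫ P Δφ = −∫ D²φ(U,U)` for every `φ ∈ C^∞_c(ℝ³)` — Chae–Shvydkoy's (2.3)
"`q = −(1/N)|v|² + p.v. ∫ K_{ij}(x−y) vᵢ(y)vⱼ(y) dy`" in weak form, i.e. `−Δq = ∂ᵢ∂ⱼ(vᵢvⱼ)` — follows
from the profile equation alone: test it against `∇φ` and integrate by parts; the linear terms
drop out because `div U = 0` (`∫⟪U,∇φ⟫ = 0`, and `∫⟪DU·(y−c), ∇φ⟫ = −∫D²φ(U, y−c) − 3∫⟪U,∇φ⟫ = 0`
since `∫⟪U, ∇(Dφ·(y−c))⟫ = 0`), the convective term gives `−∫ D²φ(U,U)` and the pressure term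
`−∫ P Δφ`. Hence the hypothesis "`P` is the associated pressure (weak Poisson equation)" in the
tree's renderings of CS13 Theorem 3.2 / Corollary 3.4 is redundant given `P ∈ L^{p/2}`:

* `IsSelfSimilarEulerProfile.weakPoisson`;
* `IsSelfSimilarEulerProfile.eq_zero_of_memLp'` (Thm 3.2, `3 < p < ∞`, both ranges, hypotheses:
  profile, `U ∈ L^p`, `P ∈ L^{p/2}` only), `chaeShvydkoy2013_Lp_exclusion_thm'`;
* `IsSelfSimilarEulerProfile.energyGrowth_of_memLp_of_window'` (Cor 3.4),
  `chaeShvydkoy2013_energy_growth_thm'`.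

[ChaeShvydkoy2013] D. Chae, R. Shvydkoy, *On formation of a locally self-similar collapse in the
incompressible Euler equations*, ARMA 209 (2013) = arXiv:1201.6009, §2.1 (2.3), §3.2.

## Mathlib / tree search

Reused: `integral_inner_convect_add_eq_zero`, `integral_mul_divergence_add_eq_zero_left`,
`integral_inner_gradient_eq_neg_integral_mul_divergence` (`WholeSpaceIBP`), `divergence_gradient`
(`PressurePoisson`), `chaeShvydkoy2013_Lp_exclusion_holds` (`SelfSimilarEulerLpExclusionHolds`),
`chaeShvydkoy2013_energy_growth_holds`, `IsSelfSimilarEulerProfile.energyGrowth_of_memLp_of_window`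
(`SelfSimilarEulerEnergyGrowth`); Mathlib `HasFDerivAt.clm_apply`, `ContDiffAt.isSymmSndFDerivAt`,
`LinearIsometryEquiv.hasFDerivAt`, `InnerProductSpace.toDual_symm_apply`.
No new definitions, no instances, no notation.
-/

noncomputable section

open MeasureTheory Set Filter Topology Metric InnerProductSpace
open scoped RealInnerProductSpace ENNReal NNReal Laplacian

namespace Literature.Analysis.FluidPDE

/-! ## Calculus of the test field `∇φ` -/

/-- `⟪a, D(∇φ)(y) b⟫ = D²φ(y) b a` for `φ ∈ C²`. [folklore] -/
private theorem inner_fderiv_gradient_apply_aux {φ : EuclideanSpace ℝ (Fin 3) → ℝ}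
    (hφ : ContDiff ℝ 2 φ) (y a b : EuclideanSpace ℝ (Fin 3)) :
    ⟪a, fderiv ℝ (gradient φ) y b⟫ = fderiv ℝ (fderiv ℝ φ) y b a := by
  have h1 : ContDiff ℝ 1 (fderiv ℝ φ) := hφ.fderiv_right (m := 1) le_rfl
  have hd : HasFDerivAt (gradient φ)
      (((InnerProductSpace.toDual ℝ (EuclideanSpace ℝ (Fin 3))).symm :
        (EuclideanSpace ℝ (Fin 3) →L[ℝ] ℝ) →L[ℝ] EuclideanSpace ℝ (Fin 3)).comp
        (fderiv ℝ (fderiv ℝ φ) y)) y :=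
    (InnerProductSpace.toDual ℝ (EuclideanSpace ℝ (Fin 3))).symm.toContinuousLinearEquiv
      |>.hasFDerivAt.comp y ((h1.differentiable one_ne_zero y).hasFDerivAt)
  rw [hd.fderiv, ContinuousLinearMap.comp_apply, real_inner_comm]
  exact InnerProductSpace.toDual_symm_apply

/-- `⟪∇θ(y), v⟫ = Dθ(y) v`. [folklore] -/
private theorem inner_gradient_eq_fderiv_ssp {θ : EuclideanSpace ℝ (Fin 3) → ℝ}
    (y v : EuclideanSpace ℝ (Fin 3)) : ⟪gradient θ y, v⟫ = fderiv ℝ θ y v := by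
  rw [gradient, InnerProductSpace.toDual_symm_apply]

/-- `div (y ↦ y − c) = 3` on `ℝ³`. [folklore] -/
private theorem divergence_sub_const_eq_three (c y : EuclideanSpace ℝ (Fin 3)) :
    VectorCalculus.divergence (fun x : EuclideanSpace ℝ (Fin 3) => x - c) y = 3 := by
  rw [VectorCalculus.divergence, fderiv_sub_const, fderiv_fun_id]
  have := LinearMap.trace_id ℝ (EuclideanSpace ℝ (Fin 3))
  rw [finrank_euclideanSpace_fin] at this
  exact_mod_cast this

/-! ## The weak pressure–Poisson equation of a profile -/

/-- **The associated-pressure (weak Poisson) equation is automatic.** For every stationary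
self-similar Euler profile `(U, P)` (any exponent `γ`, any centre `c`) and every
`φ ∈ C^∞_c(ℝ³)`: `∫ P Δφ = −∫ D²φ(U, U)`, i.e. `−ΔP = ∂ᵢ∂ⱼ(UᵢUⱼ)` in the sense of distributions
(CS13 (2.3) in weak form; proof: test the profile equation against `∇φ`).
[cite: ChaeShvydkoy2013, §2.1 eq. (2.3)] -/
theorem IsSelfSimilarEulerProfile.weakPoisson {γ : ℝ} {c : EuclideanSpace ℝ (Fin 3)}
    {U : EuclideanSpace ℝ (Fin 3) → EuclideanSpace ℝ (Fin 3)} {P : EuclideanSpace ℝ (Fin 3) → ℝ}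
    (h : IsSelfSimilarEulerProfile γ c U P) {φ : EuclideanSpace ℝ (Fin 3) → ℝ}
    (hφ : ContDiff ℝ (⊤ : ℕ∞) φ) (hφc : HasCompactSupport φ) :
    ∫ x, P x * (Δ φ) x = -∫ x, fderiv ℝ (fderiv ℝ φ) x (U x) (U x) := by
  have hU1 : ContDiff ℝ 1 U := h.contDiff_velocity.of_le one_le_two
  have hUc : Continuous U := hU1.continuous
  have hDUc : Continuous (fderiv ℝ U) := hU1.continuous_fderiv one_ne_zero
  have hPc : Continuous P := h.contDiff_pressure.continuous
  have h2top : ((2 : ℕ∞) : WithTop ℕ∞) ≤ ((⊤ : ℕ∞) : WithTop ℕ∞) := by exact_mod_cast le_top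
  have h1top : ((1 : ℕ∞) : WithTop ℕ∞) ≤ ((⊤ : ℕ∞) : WithTop ℕ∞) := by exact_mod_cast le_top
  have hφ2 : ContDiff ℝ 2 φ := hφ.of_le h2top
  have hφ1 : ContDiff ℝ 1 φ := hφ.of_le h1top
  have hD1 : ContDiff ℝ 1 (fderiv ℝ φ) := hφ2.fderiv_right (m := 1) le_rfl
  have hD2c : Continuous (fderiv ℝ (fderiv ℝ φ)) := hD1.continuous_fderiv one_ne_zero
  -- the test field `ψ = ∇φ`
  have hψ1 : ContDiff ℝ 1 (gradient φ) :=
    (InnerProductSpace.toDual ℝ (EuclideanSpace ℝ (Fin 3))).symm.contDiff.comp hD1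
  have hψsupp : HasCompactSupport (gradient φ) :=
    (hφc.fderiv (𝕜 := ℝ)).mono fun y hy => by
      contrapose! hy
      simp only [Function.mem_support, not_not] at hy ⊢
      simp [gradient, hy]
  have hψcont : Continuous (gradient φ) := hψ1.continuous
  have hDψc : HasCompactSupport (fderiv ℝ (fderiv ℝ φ)) := (hφc.fderiv (𝕜 := ℝ)).fderiv (𝕜 := ℝ)
  -- symmetry of `D²φ`
  have hsymm : ∀ y v w : EuclideanSpace ℝ (Fin 3), fderiv ℝ (fderiv ℝ φ) y v w =
      fderiv ℝ (fderiv ℝ φ) y w v := fun y v w =>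
    (hφ2.contDiffAt.isSymmSndFDerivAt (by simp)).eq v w
  -- integrability helper: continuous integrands supported in `tsupport ψ` / `tsupport D²φ`
  have hint_ψ : ∀ {g : EuclideanSpace ℝ (Fin 3) → EuclideanSpace ℝ (Fin 3)}, Continuous g →
      Integrable (fun y => ⟪g y, gradient φ y⟫) (volume : Measure (EuclideanSpace ℝ (Fin 3))) :=
    fun hg => (hg.inner hψcont).integrable_of_hasCompactSupport
      (hψsupp.mono fun y hy => by
        contrapose! hy
        simp only [Function.mem_support, not_not] at hy ⊢
        rw [hy, inner_zero_right])
  -- (T1) `∫⟪U, ∇φ⟫ = 0`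
  have hT1 : ∫ y, ⟪U y, gradient φ y⟫ = 0 := by
    have h0 := integral_mul_divergence_add_eq_zero_left hφ1 hU1 hφc
    have hz : (fun y => φ y * VectorCalculus.divergence U y) = fun _ => 0 := by
      funext y; rw [h.divFree y, mul_zero]
    rw [hz, integral_zero, zero_add] at h0
    exact h0
  -- (T5) `∫ D²φ(y)(U y)(y − c) = 0`, from `∫⟪U, ∇θ⟫ = 0` with `θ = Dφ(y)(y − c)`
  have hT5 : ∫ y, fderiv ℝ (fderiv ℝ φ) y (U y) (y - c) = 0 := by
    set θ : EuclideanSpace ℝ (Fin 3) → ℝ := fun y => fderiv ℝ φ y (y - c) with hθ_def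
    have hθ1 : ContDiff ℝ 1 θ := hD1.clm_apply (contDiff_id.sub contDiff_const)
    have hθc : HasCompactSupport θ :=
      (hφc.fderiv (𝕜 := ℝ)).mono fun y hy => by
        contrapose! hy
        simp only [Function.mem_support, not_not] at hy ⊢
        simp [hθ_def, hy]
    have hDθ : ∀ y v, fderiv ℝ θ y v = fderiv ℝ φ y v + fderiv ℝ (fderiv ℝ φ) y v (y - c) := by
      intro y v
      have hd : HasFDerivAt θ ((fderiv ℝ φ y).comp (ContinuousLinearMap.id ℝ _) +
          (fderiv ℝ (fderiv ℝ φ) y).flip (y - c)) y :=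
        ((hD1.differentiable one_ne_zero y).hasFDerivAt).clm_apply
          ((hasFDerivAt_id y).sub_const c)
      rw [hd.fderiv]
      simp
    have h0 := integral_mul_divergence_add_eq_zero_left hθ1 hU1 hθc
    have hz : (fun y => θ y * VectorCalculus.divergence U y) = fun _ => 0 := by
      funext y; rw [h.divFree y, mul_zero]
    rw [hz, integral_zero, zero_add] at h0
    have h1 : (fun y => ⟪U y, gradient θ y⟫) =
        fun y => ⟪U y, gradient φ y⟫ + fderiv ℝ (fderiv ℝ φ) y (U y) (y - c) := by
      funext y
      rw [real_inner_comm, inner_gradient_eq_fderiv_ssp, hDθ, real_inner_comm, inner_gradient_eq_fderiv_ssp]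
    rw [h1, integral_add (hint_ψ hUc)] at h0
    · rw [hT1, zero_add] at h0
      exact h0
    · exact ((hD2c.clm_apply hUc).clm_apply (continuous_id.sub continuous_const))
        |>.integrable_of_hasCompactSupport (hDψc.mono fun y hy => by
          contrapose! hy
          simp only [Function.mem_support, not_not] at hy ⊢
          simp [hy])
  -- (T2) `∫⟪DU·(y − c), ∇φ⟫ = 0`
  have hT2 : ∫ y, ⟪fderiv ℝ U y (y - c), gradient φ y⟫ = 0 := by
    have h0 := integral_inner_convect_add_eq_zero
      (u := fun y : EuclideanSpace ℝ (Fin 3) => y - c) (v := U) (w := gradient φ)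
      (contDiff_id.sub contDiff_const) hU1 hψ1 hψsupp
    have ha : (fun y => ⟪convect (fun y : EuclideanSpace ℝ (Fin 3) => y - c) U y, gradient φ y⟫) =
        fun y => ⟪fderiv ℝ U y (y - c), gradient φ y⟫ := by
      funext y; rfl
    have hb : (fun y => ⟪U y, convect (fun y : EuclideanSpace ℝ (Fin 3) => y - c) (gradient φ) y⟫)
        = fun y => fderiv ℝ (fderiv ℝ φ) y (U y) (y - c) := by
      funext y
      simp only [convect]
      rw [inner_fderiv_gradient_apply_aux hφ2, hsymm]
    have hc' : (fun y => VectorCalculus.divergence (fun y : EuclideanSpace ℝ (Fin 3) => y - c) y *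
        ⟪U y, gradient φ y⟫) = fun y => 3 * ⟪U y, gradient φ y⟫ := by
      funext y; rw [divergence_sub_const_eq_three]
    rw [ha, hb, hc', integral_const_mul, hT5, hT1] at h0
    linarith
  -- (T3) `∫⟪DU·U, ∇φ⟫ = −∫ D²φ(U,U)`
  have hT3 : ∫ y, ⟪fderiv ℝ U y (U y), gradient φ y⟫ =
      -∫ y, fderiv ℝ (fderiv ℝ φ) y (U y) (U y) := by
    have h0 := integral_inner_convect_add_eq_zero (u := U) (v := U) (w := gradient φ)
      hU1 hU1 hψ1 hψsupp
    have ha : (fun y => ⟪convect U U y, gradient φ y⟫) =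
        fun y => ⟪fderiv ℝ U y (U y), gradient φ y⟫ := by
      funext y; rfl
    have hb : (fun y => ⟪U y, convect U (gradient φ) y⟫) =
        fun y => fderiv ℝ (fderiv ℝ φ) y (U y) (U y) := by
      funext y
      simp only [convect]
      rw [inner_fderiv_gradient_apply_aux hφ2]
    have hc' : (fun y => VectorCalculus.divergence U y * ⟪U y, gradient φ y⟫) = fun _ => 0 := by
      funext y; rw [h.divFree y, zero_mul]
    rw [ha, hb, hc', integral_zero, add_zero] at h0
    linarith
  -- (T4) `∫⟪∇P, ∇φ⟫ = −∫ P Δφ`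
  have hT4 : ∫ y, ⟪gradient P y, gradient φ y⟫ = -∫ y, P y * (Δ φ) y := by
    rw [integral_inner_gradient_eq_neg_integral_mul_divergence h.contDiff_pressure hψ1 hψsupp]
    congr 1
    refine integral_congr_ae (Eventually.of_forall fun y => ?_)
    simp only
    rw [divergence_gradient hφ2]
  -- the profile equation tested against `∇φ`
  have hpt : ∀ y, (1 - γ) * ⟪U y, gradient φ y⟫ + γ * ⟪fderiv ℝ U y (y - c), gradient φ y⟫ +
      ⟪fderiv ℝ U y (U y), gradient φ y⟫ + ⟪gradient P y, gradient φ y⟫ = 0 := by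
    intro y
    have he := congrArg (fun v => ⟪v, gradient φ y⟫) (h.profile_eq y)
    simp only [inner_add_left, inner_smul_left, map_add, map_smul, inner_zero_left,
      RCLike.conj_to_real] at he
    linarith
  have hI : ∫ y, ((1 - γ) * ⟪U y, gradient φ y⟫ + γ * ⟪fderiv ℝ U y (y - c), gradient φ y⟫ +
      ⟪fderiv ℝ U y (U y), gradient φ y⟫ + ⟪gradient P y, gradient φ y⟫) = 0 := by
    simp only [hpt, integral_zero]
  have i1 : Integrable (fun y => (1 - γ) * ⟪U y, gradient φ y⟫)
      (volume : Measure (EuclideanSpace ℝ (Fin 3))) := (hint_ψ hUc).const_mul _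
  have i2 : Integrable (fun y => γ * ⟪fderiv ℝ U y (y - c), gradient φ y⟫)
      (volume : Measure (EuclideanSpace ℝ (Fin 3))) :=
    (hint_ψ (hDUc.clm_apply (continuous_id.sub continuous_const))).const_mul _
  have i3 : Integrable (fun y => ⟪fderiv ℝ U y (U y), gradient φ y⟫)
      (volume : Measure (EuclideanSpace ℝ (Fin 3))) := hint_ψ (hDUc.clm_apply hUc)
  have i4 : Integrable (fun y => ⟪gradient P y, gradient φ y⟫)
      (volume : Measure (EuclideanSpace ℝ (Fin 3))) :=
    hint_ψ (continuous_gradient_of_contDiff h.contDiff_pressure)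
  have i12 : Integrable (fun y => (1 - γ) * ⟪U y, gradient φ y⟫ +
      γ * ⟪fderiv ℝ U y (y - c), gradient φ y⟫) (volume : Measure (EuclideanSpace ℝ (Fin 3))) :=
    i1.add i2
  have i123 : Integrable (fun y => (1 - γ) * ⟪U y, gradient φ y⟫ +
      γ * ⟪fderiv ℝ U y (y - c), gradient φ y⟫ + ⟪fderiv ℝ U y (U y), gradient φ y⟫)
      (volume : Measure (EuclideanSpace ℝ (Fin 3))) := i12.add i3
  rw [integral_add i123 i4, integral_add i12 i3, integral_add i1 i2, integral_const_mul,
    integral_const_mul, hT1, hT2, hT3, hT4] at hI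
  linarith

/-! ## Chae–Shvydkoy 2013, Theorem 3.2 and Corollary 3.4 without the weak-Poisson hypothesis -/

/-- **Theorem 3.2, `3 < p < ∞`, both ranges, hypotheses: profile, `U ∈ L^p`, `P ∈ L^{p/2}`.**
[cite: ChaeShvydkoy2013, §3.2 Thm. 3.2] -/
theorem IsSelfSimilarEulerProfile.eq_zero_of_memLp' {α p : ℝ}
    {U : EuclideanSpace ℝ (Fin 3) → EuclideanSpace ℝ (Fin 3)} {P : EuclideanSpace ℝ (Fin 3) → ℝ}
    (h : IsSelfSimilarEulerProfile (1 / (α + 1)) 0 U P) (hα : -1 < α) (hp : 3 < p)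
    (hrange : α ≤ 3 / p ∨ 3 / 2 < α) (hU : MemLp U (ENNReal.ofReal p) volume)
    (hP : MemLp P (ENNReal.ofReal (p / 2)) volume) : U = 0 :=
  h.eq_zero_of_memLp hα hp hrange hU hP fun _ hφ hφc => h.weakPoisson hφ hφc

/-- **Theorem 3.2 in the fact's binder shape, every `3 ≤ p < ∞`, without the weak-Poisson
hypothesis.** [cite: ChaeShvydkoy2013, §3.2 Thm. 3.2] -/
theorem chaeShvydkoy2013_Lp_exclusion_thm' (α : ℝ) (p : ℝ≥0∞)
    (U : EuclideanSpace ℝ (Fin 3) → EuclideanSpace ℝ (Fin 3)) (P : EuclideanSpace ℝ (Fin 3) → ℝ)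
    (hα : -1 < α) (h3 : 3 ≤ p) (htop : p ≠ ∞) (hrange : α ≤ 3 / p.toReal ∨ 3 / 2 < α)
    (hprof : IsSelfSimilarEulerProfile (1 / (α + 1)) 0 U P)
    (hU : MemLp U p volume) (hP : MemLp P (p / 2) volume) : U = 0 :=
  chaeShvydkoy2013_Lp_exclusion_holds α p U P hα h3 htop hrange hprof hU hP
    fun _ hφ hφc => hprof.weakPoisson hφ hφc

/-- **Corollary 3.4, every `3 ≤ p < ∞`, window `3/p < α ≤ 3/2`, hypotheses: profile, `U ∈ L^p`,
`P ∈ L^{p/2}`.** [cite: ChaeShvydkoy2013, §3.2.3 Cor. 3.4] -/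
theorem IsSelfSimilarEulerProfile.energyGrowth_of_memLp_of_window' {α p : ℝ}
    {U : EuclideanSpace ℝ (Fin 3) → EuclideanSpace ℝ (Fin 3)} {P : EuclideanSpace ℝ (Fin 3) → ℝ}
    (h : IsSelfSimilarEulerProfile (1 / (α + 1)) 0 U P) (hp : 3 ≤ p) (hαp : 3 / p < α)
    (hα2 : α ≤ 3 / 2) (hU : MemLp U (ENNReal.ofReal p) volume)
    (hP : MemLp P (ENNReal.ofReal (p / 2)) volume) :
    ∃ C : ℝ, 0 ≤ C ∧ ∀ R : ℝ, 1 ≤ R →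
      ∫ y in ball (0 : EuclideanSpace ℝ (Fin 3)) R, ‖U y‖ ^ 2 ≤ C * R ^ (3 - 2 * α) :=
  h.energyGrowth_of_memLp_of_window hp hαp hα2 hU hP fun _ hφ hφc => h.weakPoisson hφ hφc

/-- **Corollary 3.4 in the fact's binder shape, without the weak-Poisson hypothesis.**
[cite: ChaeShvydkoy2013, §3.2.3 Cor. 3.4] -/
theorem chaeShvydkoy2013_energy_growth_thm' (α : ℝ) (p : ℝ≥0∞)
    (U : EuclideanSpace ℝ (Fin 3) → EuclideanSpace ℝ (Fin 3)) (P : EuclideanSpace ℝ (Fin 3) → ℝ)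
    (h3 : 3 ≤ p) (htop : p ≠ ∞) (hαp : 3 / p.toReal < α) (hα2 : α ≤ 3 / 2)
    (hprof : IsSelfSimilarEulerProfile (1 / (α + 1)) 0 U P)
    (hU : MemLp U p volume) (hP : MemLp P (p / 2) volume) :
    ∃ C L₀ : ℝ, 0 < L₀ ∧ ∀ L : ℝ, L₀ ≤ L →
      ∫ y in ball (0 : EuclideanSpace ℝ (Fin 3)) L, ‖U y‖ ^ 2 ≤ C * L ^ (3 - 2 * α) :=
  chaeShvydkoy2013_energy_growth_holds α p U P h3 htop hαp hα2 hprof hU hP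
    fun _ hφ hφc => hprof.weakPoisson hφ hφc

/-- **The endpoint `α = 3/2` without the weak-Poisson hypothesis: an `L^p` profile with
`L^{p/2}` pressure has finite energy.** [cite: ChaeShvydkoy2013, §1 and §3.2.3 Cor. 3.4 (α = N/2)] -/
theorem IsSelfSimilarEulerProfile.ballEnergy_bounded_of_memLp_of_three_halves' {p : ℝ}
    {U : EuclideanSpace ℝ (Fin 3) → EuclideanSpace ℝ (Fin 3)} {P : EuclideanSpace ℝ (Fin 3) → ℝ}
    (h : IsSelfSimilarEulerProfile (1 / ((3 / 2 : ℝ) + 1)) 0 U P) (hp : 3 ≤ p)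
    (hU : MemLp U (ENNReal.ofReal p) volume) (hP : MemLp P (ENNReal.ofReal (p / 2)) volume) :
    ∃ C : ℝ, ∀ R : ℝ, 1 ≤ R → ∫ y in ball (0 : EuclideanSpace ℝ (Fin 3)) R, ‖U y‖ ^ 2 ≤ C :=
  h.ballEnergy_bounded_of_memLp_of_three_halves hp hU hP fun _ hφ hφc => h.weakPoisson hφ hφc

end Literature.Analysis.FluidPDE
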